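import Summits.CriticalPhenomena.PercolationContinuityZ3.Theorems.PercNearOneGluingNoHeavyLowerTailClusterDeletionBlockChampion
import Summits.CriticalPhenomena.PercolationContinuityZ3.Theorems.PercNearOneGluingNoHeavyLowerTailMonoRhoCexTools
import HarnessLib

/-!
# `NoHeavyLowerTail` (stmt-CriticalPhenomena-4575) — the cluster-deletion step for the block-champion (PL-block)
# potential `ΦD_C` is FALSE for every `C ≥ 0`: a certified seven-vertex witness (closed door in the tree)

Prover `prim-lf-5` (lemma factory #5, blob-quotient / deletion induction on `|A|`), gen 5, 2026-08-19;
`--supports stmt-CriticalPhenomena-4575`.  No named facts, no sorries; the `def`s are computable exact-rational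
evaluators and witness data only (pattern of `…MonoRhoCexTools.lean`, `…WorstPairExchangeCex.lean`).  COMPUTATIONAL
file: the single arithmetic fact `wit7_check` is evaluated by `native_decide` (one table of 2¹⁶ weighted reach tables,
≈ 80 s).

The typed reduction `noHeavyLowerTail_of_blockChampionDeletionStep (C) (hC) (hstep)` (`…ClusterDeletionBlockChampion.lean`,
p188880) closes the crux from the ONE-STEP inequality `ΦD_C` of the cluster-deletion induction
(run/shared/lean/prim/prim-lf-5/CLUSTER-DELETION.md): with `π(v) = {a ∈ A : v ↔ a}`, the block-champion potential
`Φ(w, A, o, j) = Σ_{B ⊆ A} μ_w{π(o) = B} · max_{c ∈ B} μ_w{|π(c)| ≤ j}` and `w ∖ K` = `w` with every pair meeting `K`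
given weight `0`, `hstep` asks that EVERY instance has a relay `y ∈ A` with

  `μ_w{o ↔ y, |π(y)| ≤ j} + C · Σ_{K ∋ y, K ∌ o} μ_w{C(y) = K} · Φ(w ∖ K, A ∖ K, o, j) ≤ C · Φ(w, A, o, j)`.

**This file proves `hstep` is false for every `C ≥ 0`** (`blockChampionDeletionStep_false`), so that reduction is
vacuous.  WITNESS (`wit7`, the seat's PHID-CEX-n7.json with an extra observer edge `0–6` so that also `C = 0` fails):
`Fin 7`, observer `0`, relays `A = {1,…,6}`, level `j = 1`; two mutually "cross-suppressing" relay triangles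
`12 (29/50), 13 (377/500), 23 (681/1000)` and `45 (139/1000), 46 (911/1000), 56 (159/200)`, cross pairs
`15 (1/4), 25 (103/250), 26 (2/125), 35 (13/1000)`, and a weak observer `01 (51/50000), 02 (83/100000),
03 (239/200000), 04 (159/100000), 05 (73/200000), 06 (1/100000)`.  For EVERY relay `y` the deletion term alone
exceeds the potential, `S_y := Σ_K μ{C(y) = K}·Φ(w ∖ K, A ∖ K) > Φ(w, A)` (ratios `S_y/Φ = 1.0125, 1.00056, 1.0059,
1.0112, 1.0138, 1.3199` for `y = 1,…,6`), and `f_y := μ{o ↔ y, |π(y)| ≤ 1} > 0`; hence `f_y + C·S_y > C·Φ` for all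
`C ≥ 0`.  Mechanism ("cross-suppression", CLUSTER-DELETION.md §6): each relay's isolation probability is suppressed by
its edges into both triangles; deleting any single relay's cluster un-suppresses some port's block-mates by more than
the championship mass the deleted cluster carries; found through the exact first-order matrix game of §4 there (game
value `−0.0106·max Φ`), missed by 7·10³ random exact instances.  No first-order witness with `|A| ≤ 5` was found
(annealed exact-LP search, gen 5: game value `≥ 0` in 110 restarts), which is why the certificate has 16 random pairs
and is `native_decide`-sized rather than `decide`-sized.

Contents: generic (`Fin n`) `Bool` tests on reach tables and their evaluation lemmas — `real_block` (`μ{π(o) = B}`),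
`real_light` (`μ{|π(c)| ≤ j}`), `real_f` (`μ{o ↔ y, |π(y)| ≤ j}`), `real_cluster` (`μ{C(y) = K}`); the list surgery
`delS` (all pairs meeting a vertex SET get weight `0`, `wOfList_delS`); the exact evaluators `PhiQ`, `fQ`, `SQ` with
`real_Phi`, `real_S` (the potential and the deletion term of `hstep`, for any weighted edge list); the witness and the
deliverable.  Reproduction of every number: run/shared/lean/prim/prim-lf-5/code/gen5/lean_mirror.py (brute force over
the same pruned configurations) and code/gen5/wit7_exact.py (independent partition-law engine).
-/

namespace Summit.CriticalPhenomena.PercolationContinuityZ3.Theorems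

open MeasureTheory
open Literature.Probability.LatticeModels Literature.Probability.Percolation
open Summit.CriticalPhenomena.PercolationContinuityZ3.Theorems.AdditiveGluing.Negative.Cert
open MonoRhoCex (wtabsP sum_wtabsP)
open scoped BigOperators

namespace ClusterDeletionCex

variable {n : ℕ}

/-! ### Computable part: `Bool` tests on reach tables, exact counts, the evaluators (any `n`) -/

/-- The vertices of `A` reachable from `x` according to a reach table. -/
def relF (A : Finset (Fin n)) (tb : List ℕ) (x : Fin n) : Finset (Fin n) :=
  A.filter fun z => (tb.getD x.val 0).testBit z.val = true

/-- Test: `π(o) = B`. -/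
def blockT (A B : Finset (Fin n)) (o : Fin n) (tb : List ℕ) : Bool := decide (relF A tb o = B)

/-- Test: `|π(c)| ≤ j`. -/
def lightT (A : Finset (Fin n)) (c : Fin n) (j : ℕ) (tb : List ℕ) : Bool := decide ((relF A tb c).card ≤ j)

/-- Test: `o ↔ y ∧ |π(y)| ≤ j`. -/
def fT (A : Finset (Fin n)) (o y : Fin n) (j : ℕ) (tb : List ℕ) : Bool :=
  (tb.getD o.val 0).testBit y.val && decide ((relF A tb y).card ≤ j)

/-- Test: the open cluster of `y` is exactly `K`. -/
def clusterT (K : Finset (Fin n)) (y : Fin n) (tb : List ℕ) : Bool :=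
  decide (∀ v : Fin n, v ∈ K ↔ (tb.getD y.val 0).testBit v.val = true)

/-- Exact weighted count of a test over a weighted table. -/
def cnt (T : List (List ℕ × ℚ)) (f : List ℕ → Bool) : ℚ := (T.map fun t => if f t.1 then t.2 else 0).sum

/-- The lightness table `[cnt{|π(0)| ≤ j}, …, cnt{|π(n−1)| ≤ j}]` of a weighted table (computed once). -/
def Itab (T : List (List ℕ × ℚ)) (A : Finset (Fin n)) (j : ℕ) : List ℚ :=
  (List.range n).map fun i => if h : i < n then cnt T (lightT A ⟨i, h⟩ j) else 0

/-- Contribution of one row: `weight · max_{c ∈ B} I[c]` for the block `B = π(o)` of the row (`0` if `B = ∅`). -/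
def rowVal (I : List ℚ) (B : Finset (Fin n)) (p : ℚ) : ℚ :=
  if h : B.Nonempty then p * B.sup' h (fun c => I.getD c.val 0) else 0

/-- One pass of the block-champion potential over a weighted table, given the lightness table `I`:
`Σ_rows weight · max_{c ∈ π(o)} I[c]`. -/
def PhiTI (T : List (List ℕ × ℚ)) (I : List ℚ) (A : Finset (Fin n)) (o : Fin n) : ℚ :=
  (T.map fun t => rowVal I (relF A t.1 o) t.2).sum

/-- The block-champion potential of a weighted table (`|A| + 1` passes). -/
def PhiT (T : List (List ℕ × ℚ)) (A : Finset (Fin n)) (o : Fin n) (j : ℕ) : ℚ := PhiTI T (Itab T A j) A o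

/-- The block-champion potential `Φ(wOfList l, A, o, j)` as an exact rational (pruned enumeration). -/
def PhiQ (l : List (Fin n × Fin n × ℚ)) (A : Finset (Fin n)) (o : Fin n) (j : ℕ) : ℚ := PhiT (wtabsP n l) A o j

/-- `f_y = μ{o ↔ y, |π(y)| ≤ j}` as an exact rational. -/
def fQ (l : List (Fin n × Fin n × ℚ)) (A : Finset (Fin n)) (o y : Fin n) (j : ℕ) : ℚ :=
  cnt (wtabsP n l) (fT A o y j)

/-- Vertex-SET deletion on a weighted edge list: every listed pair meeting `K` gets weight `0`. -/
def delS (K : Finset (Fin n)) (l : List (Fin n × Fin n × ℚ)) : List (Fin n × Fin n × ℚ) :=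
  l.map fun t => (t.1, t.2.1, if t.1 ∈ K ∨ t.2.1 ∈ K then 0 else t.2.2)

/-- The deletion term over a precomputed weighted table `T` of `l`:
`Σ_{K ∋ y, K ∌ o} cnt_T{C(y) = K} · PhiQ (l ∖ K) (A ∖ K)`. -/
def SQT (T : List (List ℕ × ℚ)) (l : List (Fin n × Fin n × ℚ)) (A : Finset (Fin n)) (o y : Fin n) (j : ℕ) : ℚ :=
  ∑ K ∈ (Finset.univ : Finset (Finset (Fin n))).filter (fun K => y ∈ K ∧ o ∉ K),
    cnt T (clusterT K y) * PhiQ (delS K l) (A \ K) o j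

/-- The deletion term `S_y = Σ_{K ∋ y, K ∌ o} μ{C(y) = K} · Φ(w ∖ K, A ∖ K, o, j)` as an exact rational. -/
def SQ (l : List (Fin n × Fin n × ℚ)) (A : Finset (Fin n)) (o y : Fin n) (j : ℕ) : ℚ :=
  SQT (wtabsP n l) l A o y j

/-- The check, given the table `T` of `l` and the value `P = Φ`: every relay `y ∈ A` has `f_y > 0` and `S_y > Φ`. -/
def stepFailsTP (T : List (List ℕ × ℚ)) (P : ℚ) (l : List (Fin n × Fin n × ℚ)) (A : Finset (Fin n)) (o : Fin n)
    (j : ℕ) : Bool :=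
  decide (∀ y ∈ A, 0 < cnt T (fT A o y j) ∧ P < SQT T l A o y j)

/-- **The check** `stepFails l A o j`: at the instance `(wOfList l, A, o, j)` EVERY relay `y ∈ A` has `f_y > 0` and
`S_y > Φ` — so the step inequality `f_y + C·S_y ≤ C·Φ` fails for every `y` and every `C ≥ 0`. -/
def stepFails (l : List (Fin n × Fin n × ℚ)) (A : Finset (Fin n)) (o : Fin n) (j : ℕ) : Bool :=
  stepFailsTP (wtabsP n l) (PhiT (wtabsP n l) A o j) l A o j

/-- Soundness of the check (definitional unfolding). [this file] -/
theorem stepFails_spec {l : List (Fin n × Fin n × ℚ)} {A : Finset (Fin n)} {o : Fin n} {j : ℕ}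
    (h : stepFails l A o j = true) : ∀ y ∈ A, 0 < fQ l A o y j ∧ PhiQ l A o j < SQ l A o y j := by
  simp only [stepFails, stepFailsTP, decide_eq_true_eq] at h
  exact h

/-! ### Regrouping: the one-pass potential equals the block sum of `hstep` -/

/-- Entries of the lightness table. [this file] -/
theorem Itab_getD (T : List (List ℕ × ℚ)) (A : Finset (Fin n)) (j : ℕ) (c : Fin n) :
    (Itab T A j).getD c.val 0 = cnt T (lightT A c j) := by
  rw [Itab, getD_map_range _ _ c.isLt, dif_pos c.isLt]

/-- `cnt` of a cons. [this file] -/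
theorem cnt_cons (t : List ℕ × ℚ) (T : List (List ℕ × ℚ)) (f : List ℕ → Bool) :
    cnt (t :: T) f = (if f t.1 then t.2 else 0) + cnt T f := by
  simp [cnt]

/-- Regrouping a block sum of counts as one pass over the table. [this file] -/
theorem sum_cnt_blockT (A : Finset (Fin n)) (o : Fin n) (G : Finset (Fin n) → ℚ) :
    ∀ T : List (List ℕ × ℚ),
      (∑ B ∈ A.powerset, cnt T (blockT A B o) * G B) = (T.map fun t => t.2 * G (relF A t.1 o)).sum
  | [] => by simp [cnt]
  | t :: T => by
    have ih := sum_cnt_blockT A o G T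
    have hmem : relF A t.1 o ∈ A.powerset := Finset.mem_powerset.2 (Finset.filter_subset _ _)
    simp only [cnt_cons, add_mul, Finset.sum_add_distrib, ih, List.map_cons, List.sum_cons]
    congr 1
    simp only [blockT, decide_eq_true_eq, ite_mul, zero_mul]
    rw [Finset.sum_ite_eq, if_pos hmem]

/-- **The one-pass evaluator is the block sum**:
`Σ_{B ⊆ A} cnt{π(o) = B} · max_{c ∈ B} cnt{|π(c)| ≤ j} = PhiT`. [this file] -/
theorem PhiT_slow_eq (T : List (List ℕ × ℚ)) (A : Finset (Fin n)) (o : Fin n) (j : ℕ) :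
    (∑ B ∈ A.powerset, cnt T (blockT A B o) *
        (if h : B.Nonempty then B.sup' h (fun c => cnt T (lightT A c j)) else 0)) = PhiT T A o j := by
  rw [sum_cnt_blockT, PhiT, PhiTI]
  congr 1
  refine List.map_congr_left fun t _ => ?_
  unfold rowVal
  split_ifs with h
  · congr 1
    exact Finset.sup'_congr h rfl fun c _ => (Itab_getD T A j c).symm
  · exact mul_zero _

/-! ### Measure side: the tests evaluate the events of `hstep` (any weighted edge list) -/

section Measure

open scoped Classical

/-- Per-configuration agreement of the reachable-relay set. [this file] -/
theorem relF_reachTable (A : Finset (Fin n)) (ω : List (Fin n × Fin n)) (x : Fin n) :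
    relF A (reachTable n ω) x = A.filter fun z => (↑(Eset ω) : Set (Sym2 (Fin n))) ∈ openConn x z := by
  unfold relF
  rw [Finset.filter_congr fun z _ => testBit_reachTable_iff_mem_openConn ω x z]

/-- `μ{π(o) = B}` is the count of `blockT`. [this file] -/
theorem real_block {l : List (Fin n × Fin n × ℚ)} (hnd : (wPairs l).Nodup) (hq : ∀ e ∈ l, 0 ≤ e.2.2 ∧ e.2.2 ≤ 1)
    (A B : Finset (Fin n)) (o : Fin n) :
    (prodBernoulli (wOfList l)).real {ω : BondConfig (Fin n) | (A.filter fun x => ω ∈ openConn o x) = B} =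
      ((cnt (wtabsP n l) (blockT A B o) : ℚ) : ℝ) := by
  rw [cnt, sum_wtabsP]
  refine WorstPairExchangeCex.real_eq_wcount hnd hq (blockT A B o) _ fun ω => ?_
  simp only [blockT, decide_eq_true_eq, Set.mem_setOf_eq, relF_reachTable]

/-- `μ{|π(c)| ≤ j}` is the count of `lightT`. [this file] -/
theorem real_light {l : List (Fin n × Fin n × ℚ)} (hnd : (wPairs l).Nodup) (hq : ∀ e ∈ l, 0 ≤ e.2.2 ∧ e.2.2 ≤ 1)
    (A : Finset (Fin n)) (c : Fin n) (j : ℕ) :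
    (prodBernoulli (wOfList l)).real {ω : BondConfig (Fin n) | (A.filter fun x => ω ∈ openConn c x).card ≤ j} =
      ((cnt (wtabsP n l) (lightT A c j) : ℚ) : ℝ) := by
  rw [cnt, sum_wtabsP]
  refine WorstPairExchangeCex.real_eq_wcount hnd hq (lightT A c j) _ fun ω => ?_
  simp only [lightT, decide_eq_true_eq, Set.mem_setOf_eq, relF_reachTable]

/-- `μ{o ↔ y, |π(y)| ≤ j} = fQ`. [this file] -/
theorem real_f {l : List (Fin n × Fin n × ℚ)} (hnd : (wPairs l).Nodup) (hq : ∀ e ∈ l, 0 ≤ e.2.2 ∧ e.2.2 ≤ 1)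
    (A : Finset (Fin n)) (o y : Fin n) (j : ℕ) :
    (prodBernoulli (wOfList l)).real
        (openConn o y ∩ {ω : BondConfig (Fin n) | (A.filter fun x => ω ∈ openConn y x).card ≤ j}) =
      ((fQ l A o y j : ℚ) : ℝ) := by
  rw [fQ, cnt, sum_wtabsP]
  refine WorstPairExchangeCex.real_eq_wcount hnd hq (fT A o y j) _ fun ω => ?_
  simp only [fT, Bool.and_eq_true, decide_eq_true_eq, Set.mem_inter_iff, Set.mem_setOf_eq, relF_reachTable,
    testBit_reachTable_iff_mem_openConn]

/-- `μ{C(y) = K}` is the count of `clusterT`. [this file] -/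
theorem real_cluster {l : List (Fin n × Fin n × ℚ)} (hnd : (wPairs l).Nodup) (hq : ∀ e ∈ l, 0 ≤ e.2.2 ∧ e.2.2 ≤ 1)
    (K : Finset (Fin n)) (y : Fin n) :
    (prodBernoulli (wOfList l)).real {ω : BondConfig (Fin n) | openCluster ω y = (K : Set (Fin n))} =
      ((cnt (wtabsP n l) (clusterT K y) : ℚ) : ℝ) := by
  rw [cnt, sum_wtabsP]
  refine WorstPairExchangeCex.real_eq_wcount hnd hq (clusterT K y) _ fun ω => ?_
  simp only [clusterT, decide_eq_true_eq, Set.mem_setOf_eq, testBit_reachTable_iff_mem_openConn]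
  rw [Set.ext_iff]
  simp only [Finset.mem_coe]
  exact ⟨fun h v => (h v).symm, fun h v => (h v).symm⟩

/-- `delS` does not change the listed pairs. [this file] -/
theorem wPairs_delS (K : Finset (Fin n)) (l : List (Fin n × Fin n × ℚ)) : wPairs (delS K l) = wPairs l := by
  simp [wPairs, delS]

/-- `delS` keeps the weights in `[0, 1]`. [this file] -/
theorem delS_weights (K : Finset (Fin n)) (l : List (Fin n × Fin n × ℚ)) (hq : ∀ e ∈ l, 0 ≤ e.2.2 ∧ e.2.2 ≤ 1) :
    ∀ e ∈ delS K l, 0 ≤ e.2.2 ∧ e.2.2 ≤ 1 := by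
  intro e he
  simp only [delS, List.mem_map] at he
  obtain ⟨t, ht, rfl⟩ := he
  dsimp only
  split_ifs
  · exact ⟨le_rfl, zero_le_one⟩
  · exact hq t ht

/-- Pointwise: the weight function of `delS K l` is that of `l` with the pairs meeting `K` set to `0`. [this file] -/
theorem wOfList_delS_apply (K : Finset (Fin n)) :
    ∀ (l : List (Fin n × Fin n × ℚ)) (x : Sym2 (Fin n)),
      wOfList (delS K l) x = if ∃ v ∈ K, v ∈ x then 0 else wOfList l x
  | [], x => by simp [delS, wOfList]
  | e :: l, x => by
    have ih := wOfList_delS_apply K l x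
    simp only [delS, List.map_cons] at ih ⊢
    simp only [wOfList]
    by_cases hx : x = mkE (e.1, e.2.1)
    · rw [if_pos hx, if_pos hx]
      have hmem : (∃ v ∈ K, v ∈ x) ↔ e.1 ∈ K ∨ e.2.1 ∈ K := by
        rw [hx]
        constructor
        · rintro ⟨v, hvK, hv⟩
          rcases Sym2.mem_iff.1 hv with rfl | rfl
          · exact Or.inl hvK
          · exact Or.inr hvK
        · rintro (h | h)
          · exact ⟨e.1, h, Sym2.mem_iff.2 (Or.inl rfl)⟩
          · exact ⟨e.2.1, h, Sym2.mem_iff.2 (Or.inr rfl)⟩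
      by_cases hK : e.1 ∈ K ∨ e.2.1 ∈ K
      · rw [if_pos hK, if_pos (hmem.2 hK)]
        ext
        simp [Set.projIcc]
      · rw [if_neg hK, if_neg (fun h => hK (hmem.1 h))]
    · rw [if_neg hx, if_neg hx]
      exact ih

/-- **`w ∖ K` as a weighted edge list**: `(e ↦ if e meets K then 0 else w e) = wOfList (delS K l)` for
`w = wOfList l`. [this file] -/
theorem wOfList_delS (K : Finset (Fin n)) (l : List (Fin n × Fin n × ℚ)) :
    (fun e : Sym2 (Fin n) => if ∃ v ∈ K, v ∈ e then (0 : unitInterval) else wOfList l e) = wOfList (delS K l) := by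
  funext x
  exact (wOfList_delS_apply K l x).symm

/-- Casting a `sup'` of rationals to `ℝ`. [folklore] -/
theorem cast_sup' {ι : Type*} (s : Finset ι) (h : s.Nonempty) (g : ι → ℚ) :
    ((s.sup' h g : ℚ) : ℝ) = s.sup' h (fun c => (g c : ℝ)) :=
  Finset.apply_sup'_eq_sup'_comp h ((↑) : ℚ → ℝ) (fun x y => Rat.cast_max x y)

/-- **`Φ(wOfList l, A, o, j) = PhiQ l A o j`**: the potential of `hstep` as an exact rational (any weighted edge
list). [this file] -/
theorem real_Phi {l : List (Fin n × Fin n × ℚ)} (hnd : (wPairs l).Nodup) (hq : ∀ e ∈ l, 0 ≤ e.2.2 ∧ e.2.2 ≤ 1)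
    (A : Finset (Fin n)) (o : Fin n) (j : ℕ) :
    (∑ B ∈ A.powerset,
        (prodBernoulli (wOfList l)).real {ω : BondConfig (Fin n) | (A.filter fun x => ω ∈ openConn o x) = B} *
          (if h : B.Nonempty then
              B.sup' h (fun c => (prodBernoulli (wOfList l)).real
                {ω : BondConfig (Fin n) | (A.filter fun x => ω ∈ openConn c x).card ≤ j})
            else 0)) = ((PhiQ l A o j : ℚ) : ℝ) := by
  rw [PhiQ, ← PhiT_slow_eq, Rat.cast_sum]
  refine Finset.sum_congr rfl fun B _ => ?_
  rw [Rat.cast_mul, real_block hnd hq]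
  congr 1
  split_ifs with h
  · rw [cast_sup']
    exact Finset.sup'_congr h rfl fun c _ => real_light hnd hq A c j
  · simp

/-- **The deletion term of `hstep` equals `SQ l A o y j`** (any weighted edge list). [this file] -/
theorem real_S {l : List (Fin n × Fin n × ℚ)} (hnd : (wPairs l).Nodup) (hq : ∀ e ∈ l, 0 ≤ e.2.2 ∧ e.2.2 ≤ 1)
    (A : Finset (Fin n)) (o y : Fin n) (j : ℕ) :
    (∑ K ∈ (Finset.univ : Finset (Finset (Fin n))).filter (fun K => y ∈ K ∧ o ∉ K),
        (prodBernoulli (wOfList l)).real {ω : BondConfig (Fin n) | openCluster ω y = (K : Set (Fin n))} *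
          (∑ B ∈ (A \ K).powerset,
            (prodBernoulli (fun e : Sym2 (Fin n) =>
                if ∃ v ∈ K, v ∈ e then (0 : unitInterval) else wOfList l e)).real
              {ω : BondConfig (Fin n) | ((A \ K).filter fun x => ω ∈ openConn o x) = B} *
            (if h : B.Nonempty then
                B.sup' h (fun c => (prodBernoulli (fun e : Sym2 (Fin n) =>
                    if ∃ v ∈ K, v ∈ e then (0 : unitInterval) else wOfList l e)).real
                  {ω : BondConfig (Fin n) | ((A \ K).filter fun x => ω ∈ openConn c x).card ≤ j})
              else 0))) = ((SQ l A o y j : ℚ) : ℝ) := by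
  rw [SQ, SQT, Rat.cast_sum]
  refine Finset.sum_congr rfl fun K _ => ?_
  rw [Rat.cast_mul, real_cluster hnd hq, wOfList_delS K l,
    real_Phi ((wPairs_delS K l).symm ▸ hnd) (delS_weights K l hq) (A \ K) o j]

end Measure

/-! ### The witness -/

/-- The witness: two relay triangles `123`, `456` with cross pairs, and a weak observer `0` joined to every relay. -/
def wit7 : List (Fin 7 × Fin 7 × ℚ) :=
  [(1, 2, 29/50), (1, 3, 377/500), (2, 3, 681/1000), (4, 5, 139/1000), (4, 6, 911/1000), (5, 6, 159/200),
   (1, 5, 1/4), (2, 5, 103/250), (2, 6, 2/125), (3, 5, 13/1000),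
   (0, 1, 51/50000), (0, 2, 83/100000), (0, 3, 239/200000), (0, 4, 159/100000), (0, 5, 73/200000), (0, 6, 1/100000)]

/-- The listed pairs are distinct. [this file] -/
theorem wit7_nodup : (wPairs wit7).Nodup := by decide

/-- The witness weights lie in `[0, 1]`. [this file] -/
theorem wit7_weights : ∀ e ∈ wit7, 0 ≤ e.2.2 ∧ e.2.2 ≤ 1 := by
  intro e he
  simp only [wit7, List.mem_cons, List.not_mem_nil, or_false] at he
  rcases he with rfl | rfl | rfl | rfl | rfl | rfl | rfl | rfl | rfl | rfl | rfl | rfl | rfl | rfl | rfl | rfl <;>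
    norm_num

/-- The relay set `{1,…,6}`. -/
def A6 : Finset (Fin 7) := {1, 2, 3, 4, 5, 6}

/-- **The arithmetic** (`native_decide`; one table of `2¹⁶` weighted reach tables, `|A| + 1` passes for `Φ`, and for
each relay `y` the `2⁵` cluster counts with the potentials of the deleted instances): at `wit7` every relay has
`f_y > 0` and `S_y > Φ` — ratios `S_y/Φ ≈ 1.0125, 1.00056, 1.0059, 1.0112, 1.0138, 1.3199`. [this file] -/
theorem wit7_check : stepFails wit7 A6 0 1 = true := by
  native_decide

/-- The facts read off the check. [this file] -/
theorem wit7_facts : ∀ y ∈ A6, 0 < fQ wit7 A6 0 y 1 ∧ PhiQ wit7 A6 0 1 < SQ wit7 A6 0 y 1 :=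
  stepFails_spec wit7_check

end ClusterDeletionCex

open scoped Classical in
open ClusterDeletionCex in
/-- **The cluster-deletion step `ΦD_C` for the block-champion potential is FALSE for every `C ≥ 0`.**  The hypothesis
`hstep` of `noHeavyLowerTail_of_blockChampionDeletionStep` (written VERBATIM below) fails at the seven-vertex witness
`wit7` for every `C ≥ 0`: there every relay `y ∈ A` has `μ{o ↔ y, |π(y)| ≤ 1} > 0` and
`Σ_K μ{C(y) = K}·Φ(w ∖ K, A ∖ K, o, 1) > Φ(w, A, o, 1)`.  Kernel no-go of lemma factory #5; the abstract reduction
`noHeavyLowerTail_of_clusterDeletionStep` (any potential) is unaffected. [this work] -/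
theorem blockChampionDeletionStep_false (C : ℝ) (hC : 0 ≤ C) :
    ¬ (∀ (n : ℕ) (w : Sym2 (Fin n) → unitInterval) (A : Finset (Fin n)) (o : Fin n) (j : ℕ),
      A.Nonempty → o ∉ A → ∃ y ∈ A,
        (prodBernoulli w).real (openConn o y ∩ {ω | (A.filter fun x => ω ∈ openConn y x).card ≤ j}) +
          C * ∑ K ∈ (Finset.univ : Finset (Finset (Fin n))).filter (fun K => y ∈ K ∧ o ∉ K),
            (prodBernoulli w).real {ω : BondConfig (Fin n) | openCluster ω y = (K : Set (Fin n))} *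
              (∑ B ∈ (A \ K).powerset,
                (prodBernoulli (fun e : Sym2 (Fin n) =>
                    if ∃ v ∈ K, v ∈ e then (0 : unitInterval) else w e)).real
                  {ω : BondConfig (Fin n) | ((A \ K).filter fun x => ω ∈ openConn o x) = B} *
                (if h : B.Nonempty then
                    B.sup' h (fun c => (prodBernoulli (fun e : Sym2 (Fin n) =>
                        if ∃ v ∈ K, v ∈ e then (0 : unitInterval) else w e)).real
                      {ω : BondConfig (Fin n) | ((A \ K).filter fun x => ω ∈ openConn c x).card ≤ j})
                  else 0))
        ≤ C * ∑ B ∈ A.powerset,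
            (prodBernoulli w).real {ω : BondConfig (Fin n) | (A.filter fun x => ω ∈ openConn o x) = B} *
              (if h : B.Nonempty then
                  B.sup' h (fun c => (prodBernoulli w).real
                    {ω : BondConfig (Fin n) | (A.filter fun x => ω ∈ openConn c x).card ≤ j})
                else 0)) := by
  intro hstep
  obtain ⟨y, hy, hle⟩ := hstep 7 (wOfList wit7) A6 0 1 ⟨1, by decide⟩ (by decide)
  rw [real_f wit7_nodup wit7_weights, real_S wit7_nodup wit7_weights, real_Phi wit7_nodup wit7_weights] at hle
  obtain ⟨hf, hS⟩ := wit7_facts y hy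
  have hf' : (0 : ℝ) < (fQ wit7 A6 0 y 1 : ℝ) := by exact_mod_cast hf
  have hS' : ((PhiQ wit7 A6 0 1 : ℚ) : ℝ) ≤ (SQ wit7 A6 0 y 1 : ℝ) := by exact_mod_cast hS.le
  have hCS : C * ((PhiQ wit7 A6 0 1 : ℚ) : ℝ) ≤ C * (SQ wit7 A6 0 y 1 : ℝ) := mul_le_mul_of_nonneg_left hS' hC
  linarith

end Summit.CriticalPhenomena.PercolationContinuityZ3.Theorems
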